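import Literature.Analysis.SpecialFunctions.RiemannThetaCharRank
import Literature.Analysis.SpecialFunctions.RiemannThetaCharBasis
import Mathlib.Algebra.Algebra.Operations
import Mathlib.LinearAlgebra.Basis.VectorSpace
import HarnessLib

/-!
# Koizumi's surjection theorem: `Θ_α((Ω, D), 0) · Θ_β((Ω, D), 0) = Θ_{α+β}((Ω, D), 0)`

Layer `Literature/Analysis/SpecialFunctions`, namespace `Literature.Analysis.SpecialFunctions`; lane
`lit-hodgefound` (Layer A2, seat `lit-hodgefound-skel-2`, generation 19), row **A2-75**, FILE 3 (sequel of
`RiemannThetaCharMultiplication` = the generalized addition formula (2.a), and `RiemannThetaCharRank` =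
the rank theorem, Thm. 3). ONE DEFINITION WITH A BODY (`levelThetaSpace`, Koizumi's `Θ_ℓ((z, e), 0)` for
`e = D` diagonal) and THEOREMS; no named fact, no `sorry`.

Source followed: S. Koizumi, *On the structure of the graded ℂ-algebras of theta functions*, Proc. Japan
Acad. **51** (1975) 325–328 (key `Koizumi1975GradedAlgebrasTheta`, held `paper:galaxy-pdf-7080252123399715800`),
Introduction, §1, §3 (c′), §4, §5, VERBATIM [p0001–p0005]:

> "For `α ∈ N`, `z ∈ ℌ_n` and `m = (m₁; m₂) ∈ ℝ^{2n}`, an entire function `ξ(x)` not identically zero on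
> `ℂ^n` is called a theta function of type `((z, e), m)_α`, if the period relation, for any
> `(s₁; s₂) ∈ ℤ^{2n}`, `ξ(x + (z, e)(s₁; s₂))·ξ(x)⁻¹ = e{α(−ᵗs₁x − ½ᵗs₁zs₁ + (ᵗs₁, ᵗs₂)(m₁; m₂))}`
> holds. `Θ_α((z, e), m)` is the totality of theta functions of type `((z, e), m)_α` plus `{0}`. We
> know that `Θ₀((z, e), m) = ℂ` and `Θ_α((z, e), m)` is a ℂ-vector space of dimension `αⁿ|det e|` if
> `α ∈ ℤ₊`." … "**Proposition 1** (The base theorem). For `z ∈ ℌ_n`, `k = (k₁; k₂) ∈ ℝ^{2n}` and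
> `α ∈ ℤ₊`, we have (i) `θ[k](αz | αx)` is a theta function of type `((z, e), (−α⁻¹k₂; ᵗek₁))_α`,
> (ii) `{θ[k₁ + p₁; αk₂](αz | αx) | p₁ ∈ U_{αe}}` is a ℂ-base of `Θ_α((z, e), (−k₂; ᵗek₁))`." …
> "(c′) when is the multiplication map `Θ_α((z, e), m) ⊗ Θ_β((z, e), m) → Θ_{α+β}((z, e), m)`
> surjective?" … "**Lemma 4.1.** Let `k⁽¹⁾, k⁽²⁾` be two vectors in `ℝ^{2n}` and let `z` be a point on
> `ℌ_n`. If `α, β` and `δ` are three positive integers such that `α + β < αβδ` and g.c.d.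
> `(α + β, αδ) = 1`, then we have that
> `{θ[k₁⁽¹⁾ − βc₁; αk₂⁽¹⁾](αz | αx) × θ[k₁⁽²⁾ + αc₁; βk₂⁽²⁾](βz | βx) | c₁ ∈ U_{αβδ}}` spans the space
> `Θ_{α+β}((z, 1_n), (α+β)⁻¹ × (−(αk₂⁽¹⁾ + βk₂⁽²⁾); αk₁⁽¹⁾ + βk₁⁽²⁾))`. This follows from the rank
> theorem in **3** and from the formula (4.1.a) obtained from (2.a) by certain substitutions (esp. `γ = 1`
> etc.): for `c₁ ∈ U_{αβδ}`, (4.1.a) `θ[k₁⁽¹⁾ − βc₁; αk₂⁽¹⁾](αz | αx) · θ[k₁⁽²⁾ + αc₁; βk₂⁽²⁾](βz | βx)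
> = Σ_{p₁ ∈ U_{α+β}} θ[(α+β)⁻¹(αk₁⁽¹⁾ + βk₁⁽²⁾) + αp₁; αk₂⁽¹⁾ + βk₂⁽²⁾]((α+β)z | (α+β)x)
> × θ[(α+β)⁻¹(−k₁⁽¹⁾ + k₁⁽²⁾) + c₁ − p₁; αβ(−k₂⁽¹⁾ + k₂⁽²⁾)](αβ(α+β)z | 0)`.
> **Lemma 4.2.** We have, for `α ∈ ℤ₊`, `z ∈ ℌ_n`, `k = (k₁; k₂) ∈ ℝ^{2n}` and a matrix `e` as before,
> (4.2.a) `Θ_α((z, e), (−k₂; ᵗek₁)) = ⊕_{p₁ ∈ U_e} Θ_α((z, 1_n), (−k₂; k₁ + α⁻¹p₁))`. This follows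
> directly from Proposition 1 (ii). **Theorem 4.3** (The surjection theorem). For `m⁽¹⁾, m⁽²⁾ ∈ ℝ^{2n}`;
> `α, β` and `δ ∈ ℤ₊` such that `α + β < αβδ` and g.c.d. `(α + β, αδ) = 1`; we have (4.3.a)
> `Θ_{α+β}((z, e), (α+β)⁻¹(αm⁽¹⁾ + βm⁽²⁾))
> = Σ_{d₁ ∈ U_δ} Θ_α((z, e), m⁽¹⁾ − (0; α⁻¹ᵗe d₁)) · Θ_β((z, e), m⁽²⁾ + (0; β⁻¹ᵗe d₁))`.
> The principal case (i.e., `e = 1_n`) of this theorem follows from Lemma 4.1 and the general case is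
> proved by combining the principal case and Lemma 4.2." … "**Theorem 5.1.** For `α, β ∈ ℤ₊` such that
> `α ≥ 2`, `β ≥ 3`, and `m ∈ ℝ^{2n}`, we have (5.1.a) `Θ_{α+β}((z, e), m) = Θ_α((z, e), m)·Θ_β((z, e), m)`.
> The equality `Θ₅((z, e), m) = Θ₂((z, e), m)·Θ₃((z, e), m)` follows from (4.3.a) by putting `α = 2`,
> `β = 3` and `δ = 1`, and the general case follows from the same (4.3.a) by induction.
> **Corollary 5.2.** The graded ℂ-algebra `𝒜((z, e), m)` is generated by `⋃_{1 ≤ α ≤ 4} Θ_α((z, e), m)`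
> over ℂ. **Corollary 5.3.** If `e ≡ 0 (mod γ)` for `γ ≥ 3`, the graded ℂ-algebra `𝒜((z, e), m)` is
> generated by `Θ₁((z, e), m)` over ℂ. Both corollaries are direct consequences of Theorem 5.1."

The full proofs are in S. Koizumi, Amer. J. Math. **98** (1976) 865–889, §4–§5 (key
`Koizumi1976ThetaRelations`, not held — acq-10299); the proof below is the one the note SKETCHES
("from the rank theorem in 3 and from the formula (4.1.a)"), written out at characteristic `m = 0`.

## Dictionary

* `z = Ω` (symmetric, `Im Ω ≥ c·1`, `c > 0`), `e = D = diag(d₁,…,d_g)` (`dᵢ ≥ 1`; `|det e| = ∏ dᵢ`),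
  `m = 0`; `θ[k](z | x)` = `riemannThetaChar k₁ k₂ z x`; `U_N` = `{0, 1/N, …, (N−1)/N}^g`, indexed by
  `Fin g → Fin N`; `U_{ℓe}` = `(i : Fin g) → Fin (ℓ * d i)`.
* `Θ_ℓ((Ω, D), 0)` = **`levelThetaSpace Ω d ℓ`** (§1): entire `f` with `f(x + Dλ) = f(x)` and
  `f(x + Ωλ) = exp(ℓ(−πi ᵗλΩλ − 2πi ᵗλx))·f(x)`; `levelThetaSpace Ω d 1 = typeDThetaSpace Ω d`
  (the tree's type-`D` space, `RiemannThetaCharBasis`), and `Θ_α · Θ_β ⊆ Θ_{α+β}` for the product of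
  submodules of the ℂ-algebra of functions `ℂ^g → ℂ` (`Mathlib.Algebra.Algebra.Operations`).
* "the multiplication map `Θ_α ⊗ Θ_β → Θ_{α+β}` is surjective" = the submodule equality
  `levelThetaSpace Ω d α * levelThetaSpace Ω d β = levelThetaSpace Ω d (α + β)` (the submodule product
  IS the image of the multiplication map: it is the span of the products, `Submodule.mul_le`,
  `Submodule.mul_mem_mul`).

## The proof (§3 of this file)

Fix a type `D`, levels `α, β ≥ 1` and `K` with `K ∣ αβdᵢ` (all `i`), `gcd(α + β, K) = 1`, `α + β < K`.
By Prop. 1 (ii) (`levelThetaSpace_eq_span`, from the tree's `typeDThetaSpace_eq_span` and the rescaling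
`f ↦ f(ℓ·)` of §2), `Θ_{α+β}` is spanned by `B_q(x) = ϑ[q/((α+β)D); 0]((α+β)Ω, (α+β)x)`,
`q ∈ U_{(α+β)e}`. For `κ ∈ U_K` put `f_κ(x) = ϑ[q/(αD) − βκ; 0](αΩ, αx) ∈ Θ_α` and
`g_κ(x) = ϑ[ακ; 0](βΩ, βx) ∈ Θ_β` (Prop. 1 (i), `riemannThetaChar_level_mem_levelThetaSpace`; the
memberships are where `K ∣ αβdᵢ` is used: `αD(q/(αD) − βκ)` and `βD·ακ` are integral). By (2.a) at
`γ = 1` (`riemannThetaChar_mul_riemannThetaChar`, FILE 1) — this is (4.1.a) with `c₁ = κ` —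
`f_κ · g_κ = Σ_{p ∈ U_{α+β}} B′_p · E[κ, p]`, where `B′_p(x) = ϑ[q/((α+β)D) + αp; 0]((α+β)Ω, (α+β)x)`
(so `B′_0 = B_q`) and
`E[κ, p] = ϑ[−q/(α(α+β)D) + κ − p; 0](αβ(α+β)Ω, 0)` a theta CONSTANT. The rank theorem (FILE 2,
`linearIndependent_riemannThetaChar_rank` with `(α, β) ← (α+β, K)`, columns reindexed by `p ↦ −p`,
`linearIndependent_rank_neg`) says that the `(α+β)^g` columns `p ↦ (E[κ, p])_κ` are linearly independent;
hence there is a functional `λ` on `ℂ^{U_K}` with `λ(column p) = δ_{p,0}` (`LinearMap.exists_extend`), and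
`Σ_κ λ_κ f_κ g_κ = Σ_p (Σ_κ λ_κ E[κ, p]) B′_p = B′_0 = B_q ∈ Θ_α · Θ_β` (`basis_mem_mul`). With
`Θ_α · Θ_β ⊆ Θ_{α+β}` (`levelThetaSpace_mul_le`) this is `levelThetaSpace_mul_eq`.

## Contents

* §1 **`levelThetaSpace`** (definition with body), `mem_levelThetaSpace`, `levelThetaSpace_one`
  (`= typeDThetaSpace`), `mul_mem_levelThetaSpace`, `levelThetaSpace_mul_le` (`Θ_αΘ_β ⊆ Θ_{α+β}`),
  Prop. 1 (i): `riemannThetaChar_level_mem_levelThetaSpace` (`ϑ[a; 0](ℓΩ, ℓx) ∈ Θ_ℓ` when `ℓDa ∈ ℤ^g`),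
  `riemannThetaChar_level_div_mem_levelThetaSpace`.
* §2 rescaling `comp_smul_mem_levelThetaSpace_iff` (`f(ℓ·) ∈ Θ_ℓ((Ω, D), 0) ↔ f ∈ Θ₁((ℓΩ, ℓD), 0)`),
  `levelThetaSpace_eq_map`; Prop. 1 (ii): **`levelThetaSpace_eq_span`** (the canonical base
  `ϑ[q/(ℓD); 0](ℓΩ, ℓx)`, `q ∈ U_{ℓe}`) and **`finrank_levelThetaSpace`**:
  `dim Θ_ℓ((Ω, D), 0) = ℓ^g ∏ dᵢ` ("of dimension `αⁿ|det e|`").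
* §3 **`levelThetaSpace_mul_eq`**: `Θ_α · Θ_β = Θ_{α+β}` whenever some `K` has `K ∣ αβdᵢ` (all `i`),
  `gcd(α + β, K) = 1`, `α + β < K` (private steps `linearIndependent_rank_neg`, `basis_mem_mul`).
* §4 **`levelThetaSpace_mul_eq_of_coprime`** = (4.3.a) at `δ = 1` for every type `D`: `Θ_αΘ_β = Θ_{α+β}`
  for coprime `α, β ≥ 2` (`K = αβ`; Koizumi: "`Θ₅ = Θ₂·Θ₃` follows from (4.3.a) by putting `α = 2`,
  `β = 3` and `δ = 1`") — the coprime case of **Thm. 5.1**; **`levelThetaSpace_one_mul_eq`**: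
  `Θ₁Θ_k = Θ_{k+1}` when every `dᵢ` is divisible by some `δ₀` with `gcd(k + 1, δ₀) = 1`, `k + 1 < kδ₀`
  (`K = kδ₀`; the mechanism of **Cor. 5.3**, "`e ≡ 0 (mod γ)`"), and **`typeDThetaSpace_mul_self_eq`**:
  `Θ₁Θ₁ = Θ₂` for types divisible by an odd `δ₀ ≥ 3`.

## Scope (what is NOT here, and why)

* The relation to the printed hypotheses: Koizumi's "`α + β < αβδ` and g.c.d. `(α + β, αδ) = 1`" is our
  `K = αβδ` (`gcd(α+β, αδ) = 1 ⟺ gcd(α+β, αβδ) = 1`, as `gcd(α+β, α) = gcd(α, β) = gcd(α+β, β)`). In the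
  printed (4.3.a) the factors run over the SHIFTED characteristics `m⁽¹⁾ − (0; α⁻¹ᵗe d₁)`,
  `m⁽²⁾ + (0; β⁻¹ᵗe d₁)`, `d₁ ∈ U_δ`; this file has theta spaces of characteristic `m = 0` only, so it
  states (4.3.a) exactly in the cases where all these shifts are integral (one and the same summand):
  `δ = 1` (any `D`), or `δ ∣ dᵢ` for all `i` ("`e ≡ 0 (mod δ)`") — our divisibility hypothesis
  `K ∣ αβdᵢ`. Lemma 4.1 for `e = 1_n`, `δ > 1` (products of functions from DIFFERENT spaces
  `Θ_α((z, 1), (·; k₁⁽¹⁾ − βc₁))`), Lemma 4.2 (the direct sum over `U_e`) and Thm. 4.3 with its `U_δ`-sum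
  need theta spaces with characteristics and are not restated.
* Thm. 5.1 for NON-coprime `(α, β)` (e.g. `Θ₆ = Θ₃·Θ₃`, `Θ₈ = Θ₄·Θ₄`), Cor. 5.2 (generation in degrees
  `≤ 4`) and Cor. 5.3 in full (e.g. `Θ₃ = Θ₁·Θ₂` for `e ≡ 0 (mod 3)`, or even `γ`): the note says only
  "by induction" / "direct consequences"; the induction passes through shifted characteristics and is in
  the Amer. J. Math. paper (acq-10299) — NOT claimed here.
* General characteristic `m` (translates of the `m = 0` spaces) and the dictionary with the sections
  `H⁰(X, L^ℓ)` on the torus `X = ℂ^g/(Ωℤ^g ⊕ Dℤ^g)` (the tree's `ComplexTorus.thetaFunctions`, cf.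
  `thetaFunctions_siegelFactor_eq_typeDThetaSpace` for `ℓ = 1`) are left to a sequel.

## References

* [Koizumi1975GradedAlgebrasTheta] S. Koizumi, Proc. Japan Acad. 51 (1975) 325–328: Introduction
  (definition of `Θ_α((z, e), m)`), §1 Prop. 1, §3 (c′), §4 Lemma 4.1 (4.1.a), Lemma 4.2, Thm. 4.3
  (4.3.a), §5 Thm. 5.1, Cor. 5.2, Cor. 5.3 (chunks p0001–p0005).
* [Koizumi1976ThetaRelations] S. Koizumi, Theta relations and projective normality of abelian
  varieties, Amer. J. Math. 98 (1976) 865–889, §4–§5.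
* [MumfordTata1] D. Mumford, Tata Lectures on Theta I (1983), Ch. II §1.
* [LangeBirkenhake1992] H. Lange, Ch. Birkenhake, Complex Abelian Varieties, §3.2 (classical factor,
  type-`D` theta functions), §7.3 (projective normality of `L^n`, `n ≥ 3`, by Koizumi and others).
-/

noncomputable section

open Complex Real Finset Filter Topology Matrix

namespace Literature.Analysis.SpecialFunctions

variable {g : ℕ}

/-! ### §1 The level-`ℓ` theta functions of type `(Ω, D)`: Koizumi's `Θ_ℓ((z, e), 0)` -/

/-- **The classical theta functions of type `(Ω, D)` and level `ℓ`** — Koizumi's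
`Θ_ℓ((z, e), m)` for `z = Ω`, `e = D = diag(d)`, `m = 0`: entire `f : ℂ^g → ℂ` with
`f(x + Dλ²) = f(x)` and `f(x + Ωλ¹) = exp(ℓ(−πi ᵗλ¹Ωλ¹ − 2πi ᵗλ¹ x)) f(x)` (`λ¹, λ² ∈ ℤ^g`), i.e. the
theta functions for the `ℓ`-th power `e[0;0]^ℓ` of the classical factor of the type-`D` bundle on
`ℂ^g/(Ωℤ^g ⊕ Dℤ^g)` ("an entire function `ξ(x)` … is called a theta function of type `((z, e), m)_α`, if
the period relation … `ξ(x + (z, e)(s₁; s₂))·ξ(x)⁻¹ = e{α(−ᵗs₁x − ½ ᵗs₁zs₁ + (ᵗs₁, ᵗs₂)(m₁; m₂))}` holds.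
`Θ_α((z, e), m)` is the totality of theta functions of type `((z, e), m)_α` plus `{0}`").
[cite: Koizumi1975GradedAlgebrasTheta, p. 325 (definition of `Θ_α((z, e), m)`)] -/
def levelThetaSpace (Ω : Matrix (Fin g) (Fin g) ℂ) (d : Fin g → ℕ) (ℓ : ℕ) :
    Submodule ℂ ((Fin g → ℂ) → ℂ) where
  carrier := {f | Differentiable ℂ f ∧
    (∀ (z : Fin g → ℂ) (l : Fin g → ℤ), f (z + fun i => (d i : ℂ) * (l i : ℂ)) = f z) ∧
    ∀ (z : Fin g → ℂ) (l : Fin g → ℤ), f (z + Ω *ᵥ fun i => (l i : ℂ)) =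
      cexp ((ℓ : ℂ) * (-(π * I * ((fun i => (l i : ℂ)) ⬝ᵥ (Ω *ᵥ fun i => (l i : ℂ)))) -
        2 * π * I * ((fun i => (l i : ℂ)) ⬝ᵥ z))) * f z}
  zero_mem' := ⟨differentiable_const 0, fun _ _ => rfl, fun _ _ => by simp⟩
  add_mem' := by
    rintro f₁ f₂ ⟨hd₁, hp₁, hq₁⟩ ⟨hd₂, hp₂, hq₂⟩
    refine ⟨hd₁.add hd₂, fun z l => ?_, fun z l => ?_⟩
    · simp only [Pi.add_apply, hp₁, hp₂]
    · simp only [Pi.add_apply, hq₁, hq₂, mul_add]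
  smul_mem' := by
    rintro c f ⟨hd, hp, hq⟩
    refine ⟨hd.const_smul c, fun z l => ?_, fun z l => ?_⟩
    · simp only [Pi.smul_apply, hp]
    · simp only [Pi.smul_apply, hq, smul_eq_mul]
      ring

/-- Unfolding membership in `levelThetaSpace`. [cite: Koizumi1975GradedAlgebrasTheta, p. 325] -/
theorem mem_levelThetaSpace {Ω : Matrix (Fin g) (Fin g) ℂ} {d : Fin g → ℕ} {ℓ : ℕ}
    {f : (Fin g → ℂ) → ℂ} :
    f ∈ levelThetaSpace Ω d ℓ ↔ Differentiable ℂ f ∧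
      (∀ (z : Fin g → ℂ) (l : Fin g → ℤ), f (z + fun i => (d i : ℂ) * (l i : ℂ)) = f z) ∧
      ∀ (z : Fin g → ℂ) (l : Fin g → ℤ), f (z + Ω *ᵥ fun i => (l i : ℂ)) =
        cexp ((ℓ : ℂ) * (-(π * I * ((fun i => (l i : ℂ)) ⬝ᵥ (Ω *ᵥ fun i => (l i : ℂ)))) -
          2 * π * I * ((fun i => (l i : ℂ)) ⬝ᵥ z))) * f z :=
  Iff.rfl

/-- **Level one is the tree's `typeDThetaSpace`**: `Θ₁((Ω, D), 0) = H⁰(L₀)` in the classical picture.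
[cite: Koizumi1975GradedAlgebrasTheta, p. 325] [cite: LangeBirkenhake1992, §3.3.4 Exercise (4)] -/
theorem levelThetaSpace_one (Ω : Matrix (Fin g) (Fin g) ℂ) (d : Fin g → ℕ) :
    levelThetaSpace Ω d 1 = typeDThetaSpace Ω d := by
  ext f
  simp only [mem_levelThetaSpace, mem_typeDThetaSpace, Nat.cast_one, one_mul]

/-- **The graded algebra `⊕_ℓ Θ_ℓ`**: the product of theta functions of levels `α` and `β` (same type)
is a theta function of level `α + β` ("the graded ℂ-algebra `𝒜((z, e), m)` of theta functions of type
`((z, e), m)` is defined to be `⊕_α Θ_α((z, e), m)`"). [cite: Koizumi1975GradedAlgebrasTheta, p. 325] -/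
theorem mul_mem_levelThetaSpace {Ω : Matrix (Fin g) (Fin g) ℂ} {d : Fin g → ℕ} {α β : ℕ}
    {f₁ f₂ : (Fin g → ℂ) → ℂ} (h₁ : f₁ ∈ levelThetaSpace Ω d α) (h₂ : f₂ ∈ levelThetaSpace Ω d β) :
    f₁ * f₂ ∈ levelThetaSpace Ω d (α + β) := by
  obtain ⟨hd₁, hp₁, hq₁⟩ := h₁
  obtain ⟨hd₂, hp₂, hq₂⟩ := h₂
  refine ⟨hd₁.mul hd₂, fun z l => ?_, fun z l => ?_⟩
  · simp only [Pi.mul_apply, hp₁, hp₂]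
  · simp only [Pi.mul_apply, hq₁, hq₂]
    rw [show ∀ A B C D : ℂ, A * B * (C * D) = (A * C) * (B * D) from fun A B C D => by ring,
      ← Complex.exp_add]
    congr 2
    push_cast
    ring

/-- `Θ_α · Θ_β ⊆ Θ_{α+β}` as submodules of the algebra of functions.
[cite: Koizumi1975GradedAlgebrasTheta, p. 325] -/
theorem levelThetaSpace_mul_le (Ω : Matrix (Fin g) (Fin g) ℂ) (d : Fin g → ℕ) (α β : ℕ) :
    levelThetaSpace Ω d α * levelThetaSpace Ω d β ≤ levelThetaSpace Ω d (α + β) :=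
  Submodule.mul_le.mpr fun _ h₁ _ h₂ => mul_mem_levelThetaSpace h₁ h₂

/-- **Prop. 1 (i) (the base theorem, membership)**: for `a ∈ (ℓD)⁻¹ℤ^g` (`ℓ dᵢ aᵢ ∈ ℤ`), the level-`ℓ`
classical theta function `x ↦ ϑ[a; 0](ℓΩ, ℓx)` belongs to `Θ_ℓ((Ω, D), 0)` ("`θ[k](αz | αx)` is a
theta function of type `((z, e), (−α⁻¹k₂; ᵗe k₁))_α`", here `k₂ = 0`, `ᵗe k₁ = D a ∈ ℓ⁻¹ℤ^g`, which
is type `0` at level `ℓ`). [cite: Koizumi1975GradedAlgebrasTheta, §1 Prop. 1 (i)] -/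
theorem riemannThetaChar_level_mem_levelThetaSpace (Ω : Matrix (Fin g) (Fin g) ℂ)
    (hΩ : ∀ i j, Ω i j = Ω j i) {c : ℝ} (hc : 0 < c)
    (hY : ∀ x : Fin g → ℝ, c * ∑ i, x i ^ 2 ≤ ∑ i, ∑ j, x i * (Ω i j).im * x j)
    (d : Fin g → ℕ) {ℓ : ℕ} (hℓ : 0 < ℓ) (a : Fin g → ℂ) (k : Fin g → ℤ)
    (ha : ∀ i, (ℓ : ℂ) * (d i : ℂ) * a i = (k i : ℂ)) :
    (fun x : Fin g → ℂ => riemannThetaChar a 0 ((ℓ : ℂ) • Ω) ((ℓ : ℂ) • x)) ∈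
      levelThetaSpace Ω d ℓ :=
  ⟨differentiable_riemannThetaChar_level Ω hΩ hc hY hℓ a 0,
    fun z l => riemannThetaChar_level_add_type a Ω ℓ d k ha z l,
    fun z l => riemannThetaChar_level_add_mulVec a Ω hΩ ℓ z l⟩

/-- The basis functions `x ↦ ϑ[(ℓD)⁻¹q; 0](ℓΩ, ℓx)`, `q ∈ ∏ᵢ {0, …, ℓdᵢ − 1}`, lie in `Θ_ℓ((Ω, D), 0)`
(Prop. 1 (ii), membership half). [cite: Koizumi1975GradedAlgebrasTheta, §1 Prop. 1 (ii)] -/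
theorem riemannThetaChar_level_div_mem_levelThetaSpace (Ω : Matrix (Fin g) (Fin g) ℂ)
    (hΩ : ∀ i j, Ω i j = Ω j i) {c : ℝ} (hc : 0 < c)
    (hY : ∀ x : Fin g → ℝ, c * ∑ i, x i ^ 2 ≤ ∑ i, ∑ j, x i * (Ω i j).im * x j)
    (d : Fin g → ℕ) (hd : ∀ i, 0 < d i) {ℓ : ℕ} (hℓ : 0 < ℓ) (q : Fin g → ℤ) :
    (fun x : Fin g → ℂ => riemannThetaChar (fun i => (q i : ℂ) / ((ℓ : ℂ) * (d i : ℂ))) 0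
      ((ℓ : ℂ) • Ω) ((ℓ : ℂ) • x)) ∈ levelThetaSpace Ω d ℓ := by
  refine riemannThetaChar_level_mem_levelThetaSpace Ω hΩ hc hY d hℓ _ q fun i => ?_
  have h1 : (ℓ : ℂ) ≠ 0 := by exact_mod_cast hℓ.ne'
  have h2 : (d i : ℂ) ≠ 0 := by exact_mod_cast (hd i).ne'
  field_simp

/-! ### §2 Rescaling: `Θ_ℓ((Ω, D), 0) ≅ Θ₁((ℓΩ, ℓD), 0)` via `f ↦ f(ℓ·)`; the base theorem -/

/-- The homothety `x ↦ ℓx` of `ℂ^g` (`ℓ ≠ 0`) as a bijection. [folklore] -/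
private def smulEquiv (ℓ : ℂ) (hℓ : ℓ ≠ 0) : (Fin g → ℂ) ≃ (Fin g → ℂ) where
  toFun x := ℓ • x
  invFun y := ℓ⁻¹ • y
  left_inv x := by simp [smul_smul, inv_mul_cancel₀ hℓ]
  right_inv y := by simp [smul_smul, mul_inv_cancel₀ hℓ]

/-- **Rescaling**: `f(ℓ·) ∈ Θ_ℓ((Ω, D), 0)` iff `f ∈ Θ₁((ℓΩ, ℓD), 0)` (= the tree's
`typeDThetaSpace (ℓΩ) (ℓD)`), for `ℓ ≥ 1` — the substitution `w = ℓx` in the period relations.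
[cite: Koizumi1975GradedAlgebrasTheta, §1 Prop. 1] -/
theorem comp_smul_mem_levelThetaSpace_iff (Ω : Matrix (Fin g) (Fin g) ℂ) (d : Fin g → ℕ) {ℓ : ℕ}
    (hℓ : 0 < ℓ) (f : (Fin g → ℂ) → ℂ) :
    (fun x : Fin g → ℂ => f ((ℓ : ℂ) • x)) ∈ levelThetaSpace Ω d ℓ ↔
      f ∈ typeDThetaSpace ((ℓ : ℂ) • Ω) (fun i => ℓ * d i) := by
  have hℓ0 : (ℓ : ℂ) ≠ 0 := by exact_mod_cast hℓ.ne'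
  -- the three substitutions
  have eD : ∀ (z : Fin g → ℂ) (l : Fin g → ℤ),
      (ℓ : ℂ) • (z + fun i => (d i : ℂ) * (l i : ℂ)) =
        (ℓ : ℂ) • z + fun i => (((ℓ * d i : ℕ) : ℂ)) * (l i : ℂ) := by
    intro z l
    funext i
    simp only [Pi.smul_apply, Pi.add_apply, smul_eq_mul]
    push_cast
    ring
  have eΩ : ∀ (z : Fin g → ℂ) (l : Fin g → ℤ),
      (ℓ : ℂ) • (z + Ω *ᵥ fun i => (l i : ℂ)) = (ℓ : ℂ) • z + ((ℓ : ℂ) • Ω) *ᵥ fun i => (l i : ℂ) := by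
    intro z l
    rw [smul_add, Matrix.smul_mulVec]
  have eE : ∀ (z : Fin g → ℂ) (l : Fin g → ℤ),
      cexp ((ℓ : ℂ) * (-(π * I * ((fun i => (l i : ℂ)) ⬝ᵥ (Ω *ᵥ fun i => (l i : ℂ)))) -
        2 * π * I * ((fun i => (l i : ℂ)) ⬝ᵥ z))) =
      cexp (-(π * I * ((fun i => (l i : ℂ)) ⬝ᵥ (((ℓ : ℂ) • Ω) *ᵥ fun i => (l i : ℂ)))) -
        2 * π * I * ((fun i => (l i : ℂ)) ⬝ᵥ ((ℓ : ℂ) • z))) := by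
    intro z l
    congr 1
    simp only [Matrix.smul_mulVec, dotProduct_smul, smul_eq_mul]
    ring
  have hsec : ∀ w : Fin g → ℂ, (ℓ : ℂ) • ((ℓ : ℂ)⁻¹ • w) = w := fun w => by
    rw [smul_smul, mul_inv_cancel₀ hℓ0, one_smul]
  rw [mem_levelThetaSpace, mem_typeDThetaSpace]
  constructor
  · rintro ⟨hdiff, hp, hq⟩
    refine ⟨?_, fun w l => ?_, fun w l => ?_⟩
    · have hfeq : f = (fun x : Fin g → ℂ => f ((ℓ : ℂ) • x)) ∘ fun w => (ℓ : ℂ)⁻¹ • w := by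
        funext w
        simp only [Function.comp_apply, hsec]
      rw [hfeq]
      exact hdiff.comp ((differentiable_id (𝕜 := ℂ)).const_smul ((ℓ : ℂ)⁻¹))
    · have h := hp ((ℓ : ℂ)⁻¹ • w) l
      rw [eD, hsec] at h
      exact h
    · have h := hq ((ℓ : ℂ)⁻¹ • w) l
      rw [eΩ, hsec, eE, hsec] at h
      exact h
  · rintro ⟨hdiff, hp, hq⟩
    refine ⟨hdiff.comp ((differentiable_id (𝕜 := ℂ)).const_smul (ℓ : ℂ)), fun z l => ?_,
      fun z l => ?_⟩
    · rw [eD]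
      exact hp _ l
    · rw [eΩ, hq, eE]

/-- `ℓΩ`: symmetric, and `Im(ℓΩ) ≥ ℓc`. [folklore] -/
private theorem natCast_smul_hyps (Ω : Matrix (Fin g) (Fin g) ℂ) (hΩ : ∀ i j, Ω i j = Ω j i)
    {c : ℝ} (hY : ∀ x : Fin g → ℝ, c * ∑ i, x i ^ 2 ≤ ∑ i, ∑ j, x i * (Ω i j).im * x j)
    (ℓ : ℕ) :
    (∀ i j, ((ℓ : ℂ) • Ω) i j = ((ℓ : ℂ) • Ω) j i) ∧
      ∀ x : Fin g → ℝ, (ℓ : ℝ) * c * ∑ i, x i ^ 2 ≤ ∑ i, ∑ j, x i * (((ℓ : ℂ) • Ω) i j).im * x j := by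
  refine ⟨fun i j => by simp only [Matrix.smul_apply, hΩ i j], fun x => ?_⟩
  have h := smul_im_bound Ω hY (k := (ℓ : ℂ)) (Complex.natCast_im ℓ)
    (by rw [Complex.natCast_re]; exact Nat.cast_nonneg ℓ) x
  rwa [Complex.natCast_re] at h

/-- **Rescaling as a linear isomorphism**: `Θ_ℓ((Ω, D), 0)` is the image of
`Θ₁((ℓΩ, ℓD), 0) = typeDThetaSpace (ℓΩ) (ℓD)` under `f ↦ f(ℓ·)`. [cite: Koizumi1975GradedAlgebrasTheta, §1 Prop. 1] -/
theorem levelThetaSpace_eq_map (Ω : Matrix (Fin g) (Fin g) ℂ) (d : Fin g → ℕ) {ℓ : ℕ}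
    (hℓ : 0 < ℓ) :
    levelThetaSpace Ω d ℓ = (typeDThetaSpace ((ℓ : ℂ) • Ω) (fun i => ℓ * d i)).map
      (LinearEquiv.funCongrLeft ℂ ℂ (smulEquiv (g := g) (ℓ : ℂ) (by exact_mod_cast hℓ.ne')) :
        ((Fin g → ℂ) → ℂ) →ₗ[ℂ] ((Fin g → ℂ) → ℂ)) := by
  have hℓ0 : (ℓ : ℂ) ≠ 0 := by exact_mod_cast hℓ.ne'
  ext F
  rw [Submodule.mem_map]
  constructor
  · intro hF
    refine ⟨fun w => F ((ℓ : ℂ)⁻¹ • w), ?_, ?_⟩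
    · rw [← comp_smul_mem_levelThetaSpace_iff Ω d hℓ]
      have e : (fun x : Fin g → ℂ => (fun w => F ((ℓ : ℂ)⁻¹ • w)) ((ℓ : ℂ) • x)) = F := by
        funext x
        simp only [smul_smul, inv_mul_cancel₀ hℓ0, one_smul]
      rw [e]
      exact hF
    · funext x
      simp only [LinearEquiv.coe_coe, LinearEquiv.funCongrLeft_apply, LinearMap.funLeft_apply,
        smulEquiv, Equiv.coe_fn_mk, smul_smul, inv_mul_cancel₀ hℓ0, one_smul]
  · rintro ⟨f, hf, rfl⟩
    have e : ((LinearEquiv.funCongrLeft ℂ ℂ (smulEquiv (g := g) (ℓ : ℂ) hℓ0) :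
        ((Fin g → ℂ) → ℂ) →ₗ[ℂ] ((Fin g → ℂ) → ℂ)) f) = fun x : Fin g → ℂ => f ((ℓ : ℂ) • x) := by
      funext x
      simp only [LinearEquiv.coe_coe, LinearEquiv.funCongrLeft_apply, LinearMap.funLeft_apply,
        smulEquiv, Equiv.coe_fn_mk]
    rw [e, comp_smul_mem_levelThetaSpace_iff Ω d hℓ]
    exact hf

/-- **Prop. 1 (ii), the base theorem**: `Θ_ℓ((Ω, D), 0)` is spanned by the `ℓ^g d₁⋯d_g` functions
`x ↦ ϑ[(ℓD)⁻¹q; 0](ℓΩ, ℓx)`, `q ∈ ∏ᵢ {0, …, ℓdᵢ − 1}` ("`{θ[k₁ + p₁; αk₂](αz | αx) | p₁ ∈ U_{αe}}` is a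
ℂ-base of `Θ_α`", with `k = 0`), transported from the tree's `typeDThetaSpace_eq_span` at `(ℓΩ, ℓD)`.
[cite: Koizumi1975GradedAlgebrasTheta, §1 Prop. 1 (ii)] [cite: LangeBirkenhake1992, §3.3.4 Exercise (4)] -/
theorem levelThetaSpace_eq_span (Ω : Matrix (Fin g) (Fin g) ℂ) (hΩ : ∀ i j, Ω i j = Ω j i)
    {c : ℝ} (hc : 0 < c) (hY : ∀ x : Fin g → ℝ, c * ∑ i, x i ^ 2 ≤ ∑ i, ∑ j, x i * (Ω i j).im * x j)
    (d : Fin g → ℕ) (hd : ∀ i, 0 < d i) {ℓ : ℕ} (hℓ : 0 < ℓ) :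
    levelThetaSpace Ω d ℓ = Submodule.span ℂ (Set.range fun q : (i : Fin g) → Fin (ℓ * d i) =>
      fun x : Fin g → ℂ => riemannThetaChar (fun i => ((q i : ℕ) : ℂ) / ((ℓ * d i : ℕ) : ℂ)) 0
        ((ℓ : ℂ) • Ω) ((ℓ : ℂ) • x)) := by
  obtain ⟨hΩ', hY'⟩ := natCast_smul_hyps Ω hΩ hY ℓ
  have hc' : 0 < (ℓ : ℝ) * c := mul_pos (by exact_mod_cast hℓ) hc
  have hd' : ∀ i, (fun i => ℓ * d i) i ≠ 0 := fun i => (Nat.mul_pos hℓ (hd i)).ne'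
  rw [levelThetaSpace_eq_map Ω d hℓ, typeDThetaSpace_eq_span _ hΩ' hc' hY' _ hd',
    Submodule.map_span, ← Set.range_comp]
  rfl

/-- **"`Θ_α((z, e), m)` is a ℂ-vector space of dimension `αⁿ |det e|`"**: here
`dim Θ_ℓ((Ω, D), 0) = ∏ᵢ ℓdᵢ = ℓ^g · d₁⋯d_g`. [cite: Koizumi1975GradedAlgebrasTheta, p. 325 and §1 Prop. 1] -/
theorem finrank_levelThetaSpace (Ω : Matrix (Fin g) (Fin g) ℂ) (hΩ : ∀ i j, Ω i j = Ω j i)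
    {c : ℝ} (hc : 0 < c) (hY : ∀ x : Fin g → ℝ, c * ∑ i, x i ^ 2 ≤ ∑ i, ∑ j, x i * (Ω i j).im * x j)
    (d : Fin g → ℕ) (hd : ∀ i, 0 < d i) {ℓ : ℕ} (hℓ : 0 < ℓ) :
    Module.finrank ℂ (levelThetaSpace Ω d ℓ) = ℓ ^ g * ∏ i, d i := by
  obtain ⟨hΩ', hY'⟩ := natCast_smul_hyps Ω hΩ hY ℓ
  have hc' : 0 < (ℓ : ℝ) * c := mul_pos (by exact_mod_cast hℓ) hc
  have hd' : ∀ i, (fun i => ℓ * d i) i ≠ 0 := fun i => (Nat.mul_pos hℓ (hd i)).ne'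
  rw [levelThetaSpace_eq_map Ω d hℓ, LinearEquiv.finrank_map_eq,
    finrank_typeDThetaSpace _ hΩ' hc' hY' _ hd', Finset.prod_mul_distrib, Finset.prod_const,
    Finset.card_univ, Fintype.card_fin]

/-! ### §3 The surjection theorem: `Θ_α · Θ_β = Θ_{α+β}` -/

/-- `−a/N = (−a mod N)/N + n` with `n ∈ {0, −1}`: reindexing the columns of the rank matrix by
`a ↦ −a`. [folklore] -/
private theorem neg_natCast_div_eq {N : ℕ} [NeZero N] (a : Fin N) :
    -((a : ℕ) : ℂ) / (N : ℂ) =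
      (((-a : Fin N) : ℕ) : ℂ) / (N : ℂ) + ((if (a : ℕ) = 0 then (0 : ℤ) else -1 : ℤ) : ℂ) := by
  have hN : (N : ℂ) ≠ 0 := by exact_mod_cast (NeZero.ne N)
  by_cases h : (a : ℕ) = 0
  · have ha : a = 0 := Fin.ext (by rw [h]; simp)
    simp [ha]
  · have hlt : (a : ℕ) < N := a.isLt
    have hpos : 0 < (a : ℕ) := Nat.pos_of_ne_zero h
    have hneg : ((-a : Fin N) : ℕ) = N - (a : ℕ) := by
      rw [Fin.val_neg', Nat.mod_eq_of_lt (by omega)]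
    rw [if_neg h, hneg, Nat.cast_sub hlt.le]
    field_simp
    push_cast
    ring

/-- The rank theorem with the column index negated: the columns
`a ↦ (ϑ[l₁ + b/K − a/N; l₂](Ω₀, x₀))_b` are linearly independent (`gcd(N, K) = 1`, `N < K`).
[cite: Koizumi1975GradedAlgebrasTheta, §3 Thm. 3] -/
private theorem linearIndependent_rank_neg (Ω₀ : Matrix (Fin g) (Fin g) ℂ)
    (hΩ₀ : ∀ i j, Ω₀ i j = Ω₀ j i) {c : ℝ} (hc : 0 < c)
    (hY : ∀ x : Fin g → ℝ, c * ∑ i, x i ^ 2 ≤ ∑ i, ∑ j, x i * (Ω₀ i j).im * x j)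
    {N K : ℕ} (hN : 0 < N) (hNK : N < K) (hcop : Nat.Coprime N K) (l₁ l₂ x₀ : Fin g → ℂ) :
    LinearIndependent ℂ fun (a : Fin g → Fin N) (b : Fin g → Fin K) =>
      riemannThetaChar (l₁ + ((K : ℂ))⁻¹ • (fun i => ((b i : ℕ) : ℂ)) -
        ((N : ℂ))⁻¹ • (fun i => ((a i : ℕ) : ℂ))) l₂ Ω₀ x₀ := by
  haveI : NeZero N := ⟨hN.ne'⟩
  have hw := linearIndependent_riemannThetaChar_rank Ω₀ hΩ₀ hc hY hN hNK hcop l₁ l₂ x₀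
  have hσ : Function.Injective fun a : Fin g → Fin N => fun i => -a i := by
    intro a a' h
    funext i
    exact neg_injective (congr_fun h i)
  have hcomp := hw.comp _ hσ
  refine (linearIndependent_equiv' (Equiv.refl _) ?_).mp hcomp
  funext a
  funext b
  simp only [Function.comp_apply, Equiv.coe_refl, id_eq]
  have hvec : l₁ + ((K : ℂ))⁻¹ • (fun i => ((b i : ℕ) : ℂ)) - ((N : ℂ))⁻¹ • (fun i => ((a i : ℕ) : ℂ)) =
      (l₁ + ((K : ℂ))⁻¹ • (fun i => ((b i : ℕ) : ℂ)) +
        ((N : ℂ))⁻¹ • (fun i => (((-a i : Fin N) : ℕ) : ℂ))) +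
        fun i => (((if (a i : ℕ) = 0 then (0 : ℤ) else -1 : ℤ)) : ℂ) := by
    funext i
    simp only [Pi.add_apply, Pi.sub_apply, Pi.smul_apply, smul_eq_mul]
    have h := neg_natCast_div_eq (N := N) (a i)
    rw [div_eq_mul_inv, div_eq_mul_inv] at h
    linear_combination h
  rw [hvec, riemannThetaChar_charShift_fst]

/-- **The key step** (Koizumi's Lemma 4.1 / Thm. 4.3 at a fixed type `D` and characteristic `0`):
every basis function `x ↦ ϑ[((α+β)D)⁻¹q; 0]((α+β)Ω, (α+β)x)` of `Θ_{α+β}((Ω, D), 0)` is a linear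
combination of the `K^g` products
`ϑ[q/(αD) − βκ/K; 0](αΩ, αx) · ϑ[ακ/K; 0](βΩ, βx)`, `κ ∈ {0,…,K−1}^g` (members of `Θ_α` resp. `Θ_β`
when `K ∣ αβdᵢ`), by (2.a) and the rank theorem applied to the matrix
`(ϑ[−q/(α(α+β)D) + κ/K − p/(α+β); 0](αβ(α+β)Ω, 0))_{κ, p}` (`gcd(α+β, K) = 1`, `α + β < K`).
[cite: Koizumi1975GradedAlgebrasTheta, §4 Lemma 4.1, Thm. 4.3] -/
private theorem basis_mem_mul (Ω : Matrix (Fin g) (Fin g) ℂ) (hΩ : ∀ i j, Ω i j = Ω j i)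
    {c : ℝ} (hc : 0 < c) (hY : ∀ x : Fin g → ℝ, c * ∑ i, x i ^ 2 ≤ ∑ i, ∑ j, x i * (Ω i j).im * x j)
    (d : Fin g → ℕ) (hd : ∀ i, 0 < d i) {α β K : ℕ} (hα : 0 < α) (hβ : 0 < β)
    (hK : ∀ i, K ∣ α * β * d i) (hKN : Nat.Coprime (α + β) K) (hlt : α + β < K)
    (q : (i : Fin g) → Fin ((α + β) * d i)) :
    (fun x : Fin g → ℂ => riemannThetaChar (fun i => ((q i : ℕ) : ℂ) / (((α + β) * d i : ℕ) : ℂ)) 0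
      (((α + β : ℕ) : ℂ) • Ω) (((α + β : ℕ) : ℂ) • x)) ∈
      levelThetaSpace Ω d α * levelThetaSpace Ω d β := by
  classical
  have hn : 0 < α + β := by omega
  have hKpos : 0 < K := by omega
  have hN0 : ((α + β : ℕ) : ℂ) ≠ 0 := by exact_mod_cast hn.ne'
  have hα0 : (α : ℂ) ≠ 0 := by exact_mod_cast hα.ne'
  have hβ0 : (β : ℂ) ≠ 0 := by exact_mod_cast hβ.ne'
  have hK0 : (K : ℂ) ≠ 0 := by exact_mod_cast hKpos.ne'
  have hd0 : ∀ i, (d i : ℂ) ≠ 0 := fun i => by exact_mod_cast (hd i).ne'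
  have hNcast : ((α + β : ℕ) : ℂ) = (α : ℂ) + (β : ℂ) := by push_cast; ring
  obtain ⟨m, hm⟩ : ∃ m : Fin g → ℕ, ∀ i, α * β * d i = K * m i :=
    ⟨fun i => (hK i).choose, fun i => (hK i).choose_spec⟩
  have hmC : ∀ i, (α : ℂ) * β * (d i : ℂ) = (K : ℂ) * (m i : ℂ) := fun i => by exact_mod_cast hm i
  -- the two characteristics of the product family
  set aκ : (Fin g → Fin K) → Fin g → ℂ := fun κ i =>
    ((q i : ℕ) : ℂ) / ((α : ℂ) * (d i : ℂ)) - (β : ℂ) * ((κ i : ℕ) : ℂ) / (K : ℂ) with haκ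
  set bκ : (Fin g → Fin K) → Fin g → ℂ := fun κ i => (α : ℂ) * ((κ i : ℕ) : ℂ) / (K : ℂ) with hbκ
  -- memberships (Prop. 1 (i))
  have hf : ∀ κ, (fun x : Fin g → ℂ => riemannThetaChar (aκ κ) 0 ((α : ℂ) • Ω) ((α : ℂ) • x)) ∈
      levelThetaSpace Ω d α := by
    intro κ
    refine riemannThetaChar_level_mem_levelThetaSpace Ω hΩ hc hY d hα (aκ κ)
      (fun i => ((q i : ℕ) : ℤ) - (m i : ℤ) * ((κ i : ℕ) : ℤ)) fun i => ?_
    have hdi : (d i : ℂ) ≠ 0 := hd0 i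
    have e1 : (α : ℂ) * (d i : ℂ) * (((q i : ℕ) : ℂ) / ((α : ℂ) * (d i : ℂ))) = ((q i : ℕ) : ℂ) := by
      field_simp
    have e2 : (α : ℂ) * (d i : ℂ) * ((β : ℂ) * ((κ i : ℕ) : ℂ) / (K : ℂ)) =
        (m i : ℂ) * ((κ i : ℕ) : ℂ) := by
      rw [show (α : ℂ) * (d i : ℂ) * ((β : ℂ) * ((κ i : ℕ) : ℂ) / (K : ℂ)) =
        ((α : ℂ) * β * (d i : ℂ)) * ((κ i : ℕ) : ℂ) / (K : ℂ) by ring, hmC i]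
      field_simp
    simp only [haκ]
    rw [mul_sub, e1, e2]
    push_cast
    ring
  have hg : ∀ κ, (fun x : Fin g → ℂ => riemannThetaChar (bκ κ) 0 ((β : ℂ) • Ω) ((β : ℂ) • x)) ∈
      levelThetaSpace Ω d β := by
    intro κ
    refine riemannThetaChar_level_mem_levelThetaSpace Ω hΩ hc hY d hβ (bκ κ)
      (fun i => (m i : ℤ) * ((κ i : ℕ) : ℤ)) fun i => ?_
    simp only [hbκ]
    rw [show (β : ℂ) * (d i : ℂ) * ((α : ℂ) * ((κ i : ℕ) : ℂ) / (K : ℂ)) =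
      ((α : ℂ) * β * (d i : ℂ)) * ((κ i : ℕ) : ℂ) / (K : ℂ) by ring, hmC i]
    push_cast
    field_simp
  haveI : NeZero (α + β) := ⟨hn.ne'⟩
  -- vector identities turning the output of (2.a) into the required shape
  have R1 : ∀ κ, (α : ℂ) • aκ κ + (β : ℂ) • bκ κ = fun i => ((q i : ℕ) : ℂ) / (d i : ℂ) := by
    intro κ
    funext i
    have hdi : (d i : ℂ) ≠ 0 := hd0 i
    simp only [haκ, hbκ, Pi.add_apply, Pi.smul_apply, smul_eq_mul]
    field_simp
    ring
  have R3 : ∀ x : Fin g → ℂ, (α : ℂ) • x + (β : ℂ) • x = ((α + β : ℕ) : ℂ) • x := by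
    intro x
    rw [hNcast, add_smul]
  have R4 : (α : ℂ) • (0 : Fin g → ℂ) - (β : ℂ) • (0 : Fin g → ℂ) = 0 := by
    rw [smul_zero, smul_zero, sub_zero]
  have R5 : ∀ x : Fin g → ℂ, ((α : ℂ) * β) • (x - x) = 0 := fun x => by rw [sub_self, smul_zero]
  have R6 : ∀ (κ : Fin g → Fin K) (p : Fin g → Fin (α + β)),
      ((α + β : ℕ) : ℂ)⁻¹ • (bκ κ - aκ κ - fun i => ((p i : ℕ) : ℂ)) =
      (fun i => -((q i : ℕ) : ℂ) / ((α : ℂ) * ((α + β : ℕ) : ℂ) * (d i : ℂ))) +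
        ((K : ℂ))⁻¹ • (fun i => ((κ i : ℕ) : ℂ)) -
        (((α + β : ℕ) : ℂ))⁻¹ • (fun i => ((p i : ℕ) : ℂ)) := by
    intro κ p
    funext i
    have hdi : (d i : ℂ) ≠ 0 := hd0 i
    simp only [haκ, hbκ, Pi.add_apply, Pi.sub_apply, Pi.smul_apply, smul_eq_mul]
    field_simp
    rw [hNcast]
    ring
  -- THE PRODUCT FORMULA (2.a), `γ = 1`, for the family
  have hprod : ∀ (κ : Fin g → Fin K) (x : Fin g → ℂ),
      riemannThetaChar (aκ κ) 0 ((α : ℂ) • Ω) ((α : ℂ) • x) *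
        riemannThetaChar (bκ κ) 0 ((β : ℂ) • Ω) ((β : ℂ) • x) =
      ∑ p : Fin g → Fin (α + β),
        riemannThetaChar (((α + β : ℕ) : ℂ)⁻¹ • ((fun i => ((q i : ℕ) : ℂ) / (d i : ℂ)) +
            (α : ℂ) • fun i => ((p i : ℕ) : ℂ))) (0 + 0) (((α + β : ℕ) : ℂ) • Ω)
            (((α + β : ℕ) : ℂ) • x) *
        riemannThetaChar ((fun i => -((q i : ℕ) : ℂ) / ((α : ℂ) * ((α + β : ℕ) : ℂ) * (d i : ℂ))) +
            ((K : ℂ))⁻¹ • (fun i => ((κ i : ℕ) : ℂ)) -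
            (((α + β : ℕ) : ℂ))⁻¹ • (fun i => ((p i : ℕ) : ℂ))) 0
          (((α : ℂ) * β * ((α + β : ℕ) : ℂ)) • Ω) 0 := by
    intro κ x
    rw [riemannThetaChar_mul_riemannThetaChar Ω hΩ hc hY hα hβ (aκ κ) 0 (bκ κ) 0 x x]
    refine Finset.sum_congr rfl fun p _ => ?_
    rw [R1 κ, R3 x, R6 κ p, R4, R5 x]
  -- THE RANK THEOREM for the coefficient matrix (columns indexed by `p`, negated)
  have hk : ((α : ℂ) * β * ((α + β : ℕ) : ℂ)) = (((α * β * (α + β) : ℕ)) : ℂ) := by push_cast; ring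
  have hki : ((α : ℂ) * β * ((α + β : ℕ) : ℂ)).im = 0 := by rw [hk, Complex.natCast_im]
  have hkr : 0 < ((α : ℂ) * β * ((α + β : ℕ) : ℂ)).re := by
    rw [hk, Complex.natCast_re]
    exact_mod_cast (show 0 < α * β * (α + β) by positivity)
  have hΩ₂ : ∀ i j, (((α : ℂ) * β * ((α + β : ℕ) : ℂ)) • Ω) i j =
      (((α : ℂ) * β * ((α + β : ℕ) : ℂ)) • Ω) j i := fun i j => by
    simp only [Matrix.smul_apply, hΩ i j]
  have hv := linearIndependent_rank_neg (((α : ℂ) * β * ((α + β : ℕ) : ℂ)) • Ω) hΩ₂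
    (mul_pos hkr hc) (smul_im_bound Ω hY hki hkr.le) hn hlt hKN
    (fun i => -((q i : ℕ) : ℂ) / ((α : ℂ) * ((α + β : ℕ) : ℂ) * (d i : ℂ))) 0 0
  -- a linear functional picking the coefficient of `p = 0`
  obtain ⟨φ, hφ⟩ : ∃ φ : ((Fin g → Fin K) → ℂ) →ₗ[ℂ] ℂ, ∀ p : Fin g → Fin (α + β),
      φ (fun κ : Fin g → Fin K => riemannThetaChar
        ((fun i => -((q i : ℕ) : ℂ) / ((α : ℂ) * ((α + β : ℕ) : ℂ) * (d i : ℂ))) +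
            ((K : ℂ))⁻¹ • (fun i => ((κ i : ℕ) : ℂ)) -
            (((α + β : ℕ) : ℂ))⁻¹ • (fun i => ((p i : ℕ) : ℂ))) 0
          (((α : ℂ) * β * ((α + β : ℕ) : ℂ)) • Ω) 0) = if p = 0 then 1 else 0 := by
    obtain ⟨φ, hφ⟩ := LinearMap.exists_extend
      ((Finsupp.lapply (0 : Fin g → Fin (α + β))) ∘ₗ hv.repr)
    refine ⟨φ, fun p => ?_⟩
    have hmem : (fun κ : Fin g → Fin K => riemannThetaChar
        ((fun i => -((q i : ℕ) : ℂ) / ((α : ℂ) * ((α + β : ℕ) : ℂ) * (d i : ℂ))) +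
            ((K : ℂ))⁻¹ • (fun i => ((κ i : ℕ) : ℂ)) -
            (((α + β : ℕ) : ℂ))⁻¹ • (fun i => ((p i : ℕ) : ℂ))) 0
          (((α : ℂ) * β * ((α + β : ℕ) : ℂ)) • Ω) 0) ∈
        Submodule.span ℂ (Set.range fun (p : Fin g → Fin (α + β)) (κ : Fin g → Fin K) =>
          riemannThetaChar
            ((fun i => -((q i : ℕ) : ℂ) / ((α : ℂ) * ((α + β : ℕ) : ℂ) * (d i : ℂ))) +
              ((K : ℂ))⁻¹ • (fun i => ((κ i : ℕ) : ℂ)) -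
              (((α + β : ℕ) : ℂ))⁻¹ • (fun i => ((p i : ℕ) : ℂ))) 0
            (((α : ℂ) * β * ((α + β : ℕ) : ℂ)) • Ω) 0) :=
      Submodule.subset_span ⟨p, rfl⟩
    have h1 := LinearMap.congr_fun hφ ⟨_, hmem⟩
    simp only [LinearMap.coe_comp, Function.comp_apply, Submodule.coe_subtype] at h1
    rw [h1, hv.repr_eq_single p ⟨_, hmem⟩ rfl, Finsupp.lapply_apply, Finsupp.single_apply]
  -- the coefficients `λ_κ` and the identity `Σ_κ E[κ, p] λ_κ = δ_{p, 0}`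
  have hcoef : ∀ p : Fin g → Fin (α + β),
      ∑ κ : Fin g → Fin K, riemannThetaChar
        ((fun i => -((q i : ℕ) : ℂ) / ((α : ℂ) * ((α + β : ℕ) : ℂ) * (d i : ℂ))) +
            ((K : ℂ))⁻¹ • (fun i => ((κ i : ℕ) : ℂ)) -
            (((α + β : ℕ) : ℂ))⁻¹ • (fun i => ((p i : ℕ) : ℂ))) 0
          (((α : ℂ) * β * ((α + β : ℕ) : ℂ)) • Ω) 0 *
        φ (fun j : Fin g → Fin K => if κ = j then 1 else 0) = if p = 0 then 1 else 0 := by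
    intro p
    rw [← hφ p, LinearMap.pi_apply_eq_sum_univ φ]
    simp only [smul_eq_mul]
  -- R7: the `p = 0` basis function is the target function
  have R7 : ((α + β : ℕ) : ℂ)⁻¹ • ((fun i => ((q i : ℕ) : ℂ) / (d i : ℂ)) +
      (α : ℂ) • fun i => (((0 : Fin g → Fin (α + β)) i : ℕ) : ℂ)) =
      fun i => ((q i : ℕ) : ℂ) / (((α + β) * d i : ℕ) : ℂ) := by
    funext i
    have hdi : (d i : ℂ) ≠ 0 := hd0 i
    simp only [Pi.smul_apply, Pi.add_apply, Pi.zero_apply, Fin.val_zero, Nat.cast_zero,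
      smul_eq_mul, mul_zero, add_zero]
    push_cast
    field_simp
  -- ASSEMBLY
  have hfun : (fun x : Fin g → ℂ => riemannThetaChar
      (fun i => ((q i : ℕ) : ℂ) / (((α + β) * d i : ℕ) : ℂ)) 0 (((α + β : ℕ) : ℂ) • Ω)
        (((α + β : ℕ) : ℂ) • x)) =
      ∑ κ : Fin g → Fin K, φ (fun j : Fin g → Fin K => if κ = j then 1 else 0) •
        ((fun x : Fin g → ℂ => riemannThetaChar (aκ κ) 0 ((α : ℂ) • Ω) ((α : ℂ) • x)) *
          fun x : Fin g → ℂ => riemannThetaChar (bκ κ) 0 ((β : ℂ) • Ω) ((β : ℂ) • x)) := by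
    funext x
    simp only [Finset.sum_apply, Pi.smul_apply, Pi.mul_apply, smul_eq_mul]
    symm
    calc ∑ κ : Fin g → Fin K, φ (fun j : Fin g → Fin K => if κ = j then 1 else 0) *
          (riemannThetaChar (aκ κ) 0 ((α : ℂ) • Ω) ((α : ℂ) • x) *
            riemannThetaChar (bκ κ) 0 ((β : ℂ) • Ω) ((β : ℂ) • x))
        = ∑ p : Fin g → Fin (α + β),
            riemannThetaChar (((α + β : ℕ) : ℂ)⁻¹ • ((fun i => ((q i : ℕ) : ℂ) / (d i : ℂ)) +
              (α : ℂ) • fun i => ((p i : ℕ) : ℂ))) (0 + 0) (((α + β : ℕ) : ℂ) • Ω)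
              (((α + β : ℕ) : ℂ) • x) *
            ∑ κ : Fin g → Fin K, riemannThetaChar
              ((fun i => -((q i : ℕ) : ℂ) / ((α : ℂ) * ((α + β : ℕ) : ℂ) * (d i : ℂ))) +
                ((K : ℂ))⁻¹ • (fun i => ((κ i : ℕ) : ℂ)) -
                (((α + β : ℕ) : ℂ))⁻¹ • (fun i => ((p i : ℕ) : ℂ))) 0
              (((α : ℂ) * β * ((α + β : ℕ) : ℂ)) • Ω) 0 *
              φ (fun j : Fin g → Fin K => if κ = j then 1 else 0) := by
          simp_rw [hprod, Finset.mul_sum]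
          rw [Finset.sum_comm]
          refine Finset.sum_congr rfl fun p _ => Finset.sum_congr rfl fun κ _ => ?_
          ring
      _ = riemannThetaChar (fun i => ((q i : ℕ) : ℂ) / (((α + β) * d i : ℕ) : ℂ)) 0
            (((α + β : ℕ) : ℂ) • Ω) (((α + β : ℕ) : ℂ) • x) := by
          simp_rw [hcoef]
          rw [Finset.sum_eq_single (0 : Fin g → Fin (α + β)) (fun p _ hp => by rw [if_neg hp, mul_zero])
            (fun h => absurd (Finset.mem_univ _) h), if_pos rfl, mul_one, add_zero, R7]
  rw [hfun]
  exact Submodule.sum_mem _ fun κ _ =>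
    Submodule.smul_mem _ _ (Submodule.mul_mem_mul (hf κ) (hg κ))

/-- **Koizumi's surjection theorem at a fixed type (Lemma 4.1, Thm. 4.3 with integral shifts, Thm. 5.1):
`Θ_α((Ω, D), 0) · Θ_β((Ω, D), 0) = Θ_{α+β}((Ω, D), 0)`** — the multiplication map
`Θ_α ⊗ Θ_β → Θ_{α+β}` is surjective — whenever there is `K` with `K ∣ αβdᵢ` for all `i`,
`gcd(α + β, K) = 1` and `α + β < K` (Koizumi's hypotheses "`α + β < αβδ` and g.c.d. `(α+β, αδ) = 1`"
of Lemma 4.1 / Thm. 4.3 with `K = αβδ`, `δ ∣ dᵢ`, at characteristic `m = 0`). The printed Thm. 4.3 for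
general `δ` sums over shifted characteristics `m⁽¹⁾ − (0; α⁻¹ᵗe d₁)`, `m⁽²⁾ + (0; β⁻¹ᵗe d₁)`,
`d₁ ∈ U_δ`; when `δ ∣ e` these shifts are integral and all summands are the same space — the case
formalised here; the general non-coprime levels of Thm. 5.1 need the full text (Amer. J. Math. 98).
[cite: Koizumi1975GradedAlgebrasTheta, §4 Lemma 4.1, Thm. 4.3, §5 Thm. 5.1]
[cite: Koizumi1976ThetaRelations, §4–§5] -/
theorem levelThetaSpace_mul_eq (Ω : Matrix (Fin g) (Fin g) ℂ) (hΩ : ∀ i j, Ω i j = Ω j i)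
    {c : ℝ} (hc : 0 < c) (hY : ∀ x : Fin g → ℝ, c * ∑ i, x i ^ 2 ≤ ∑ i, ∑ j, x i * (Ω i j).im * x j)
    (d : Fin g → ℕ) (hd : ∀ i, 0 < d i) {α β K : ℕ} (hα : 0 < α) (hβ : 0 < β)
    (hK : ∀ i, K ∣ α * β * d i) (hKN : Nat.Coprime (α + β) K) (hlt : α + β < K) :
    levelThetaSpace Ω d α * levelThetaSpace Ω d β = levelThetaSpace Ω d (α + β) := by
  refine le_antisymm (levelThetaSpace_mul_le Ω d α β) ?_
  have hn : 0 < α + β := by omega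
  rw [levelThetaSpace_eq_span Ω hΩ hc hY d hd hn]
  refine Submodule.span_le.mpr ?_
  rintro _ ⟨q, rfl⟩
  exact basis_mem_mul Ω hΩ hc hY d hd hα hβ hK hKN hlt q

/-! ### §4 Corollaries: principal polarisations (Thm. 5.1, coprime levels) and divisible types -/

/-- **(4.3.a) at `δ = 1` — Theorem 5.1 for coprime levels**: for `Ω ∈ ℌ_g` and every type `D`,
`Θ_α((Ω, D), 0) · Θ_β((Ω, D), 0) = Θ_{α+β}((Ω, D), 0)` for all coprime `α, β ≥ 2` (then
`α + β < αβ` and `gcd(α + β, α) = 1`, Koizumi's hypotheses with `δ = 1`) — e.g. `Θ₅ = Θ₂·Θ₃` ("The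
equality `Θ₅((z, e), m) = Θ₂((z, e), m)·Θ₃((z, e), m)` follows from (4.3.a) by putting `α = 2`, `β = 3`
and `δ = 1`"), `Θ₇ = Θ₃·Θ₄ = Θ₂·Θ₅`, …: the multiplication `H⁰(L^α) ⊗ H⁰(L^β) → H⁰(L^{α+β})` is
surjective (`K = αβ` in `levelThetaSpace_mul_eq`). The non-coprime pairs of Thm. 5.1 are NOT covered
(module docstring, Scope). [cite: Koizumi1975GradedAlgebrasTheta, §4 Thm. 4.3, §5 Thm. 5.1]
[cite: Koizumi1976ThetaRelations, §5] -/
theorem levelThetaSpace_mul_eq_of_coprime (Ω : Matrix (Fin g) (Fin g) ℂ) (hΩ : ∀ i j, Ω i j = Ω j i)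
    {c : ℝ} (hc : 0 < c) (hY : ∀ x : Fin g → ℝ, c * ∑ i, x i ^ 2 ≤ ∑ i, ∑ j, x i * (Ω i j).im * x j)
    (d : Fin g → ℕ) (hd : ∀ i, 0 < d i) {α β : ℕ} (hα : 2 ≤ α) (hβ : 2 ≤ β) (hcop : Nat.Coprime α β) :
    levelThetaSpace Ω d α * levelThetaSpace Ω d β = levelThetaSpace Ω d (α + β) := by
  have h3 : 3 ≤ α ∨ 3 ≤ β := by
    by_contra h
    push Not at h
    obtain ⟨h1, h2⟩ := h
    have ha : α = 2 := by omega
    have hb : β = 2 := by omega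
    subst ha hb
    exact absurd hcop (by decide)
  refine levelThetaSpace_mul_eq Ω hΩ hc hY d hd (K := α * β) (by omega) (by omega)
    (fun i => Dvd.intro (d i) rfl) ?_ ?_
  · exact Nat.Coprime.mul_right (Nat.coprime_self_add_left.mpr hcop.symm)
      (Nat.coprime_add_self_left.mpr hcop)
  · rcases h3 with h | h <;> nlinarith

/-- **`Θ₁ · Θ_k = Θ_{k+1}` for types divisible by `δ₀` with `gcd(k + 1, δ₀) = 1`, `kδ₀ > k + 1`**
(`K = kδ₀`): e.g. if every `dᵢ` is divisible by an odd `δ₀ ≥ 3` then `Θ₂ = Θ₁·Θ₁` — Koizumi's instance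
`(α, β, δ) = (1, 1, 3)` of (4.3.a), in which the shifted characteristics are integral ("`e ≡ 0 (mod γ)`"
of Cor. 5.3) — and if every `dᵢ` is divisible by a prime `P` then `Θ_{k+1} = Θ₁·Θ_k` for all
`1 ≤ k < P − 1`: the graded algebra `⊕ Θ_k` is generated by `Θ₁` in degrees `< P`.
[cite: Koizumi1975GradedAlgebrasTheta, §4 Thm. 4.3, §5 Cor. 5.3] [cite: Koizumi1976ThetaRelations, §5] -/
theorem levelThetaSpace_one_mul_eq (Ω : Matrix (Fin g) (Fin g) ℂ) (hΩ : ∀ i j, Ω i j = Ω j i)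
    {c : ℝ} (hc : 0 < c) (hY : ∀ x : Fin g → ℝ, c * ∑ i, x i ^ 2 ≤ ∑ i, ∑ j, x i * (Ω i j).im * x j)
    (d : Fin g → ℕ) (hd : ∀ i, 0 < d i) {k δ₀ : ℕ} (hk : 0 < k) (hδ : ∀ i, δ₀ ∣ d i)
    (hcop : Nat.Coprime (k + 1) δ₀) (hlt : k + 1 < k * δ₀) :
    levelThetaSpace Ω d 1 * levelThetaSpace Ω d k = levelThetaSpace Ω d (k + 1) := by
  rw [add_comm k 1]
  refine levelThetaSpace_mul_eq Ω hΩ hc hY d hd (K := k * δ₀) Nat.one_pos hk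
    (fun i => by rw [one_mul]; exact Nat.mul_dvd_mul_left k (hδ i)) ?_ (by omega)
  rw [add_comm 1 k]
  exact Nat.Coprime.mul_right (Nat.coprime_self_add_left.mpr (Nat.coprime_one_left k)) hcop

/-- The level-one form: **`H⁰(L) ⊗ H⁰(L) → H⁰(L²)` is surjective when the type of `L` is divisible by an
odd `δ₀ ≥ 3`** (`typeDThetaSpace Ω d · typeDThetaSpace Ω d = Θ₂((Ω, D), 0)`), e.g. for `L = M³`,
`M` principal: `H⁰(M⁶) = H⁰(M³)·H⁰(M³)`. [cite: Koizumi1975GradedAlgebrasTheta, §4 Thm. 4.3, §5 Cor. 5.3] -/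
theorem typeDThetaSpace_mul_self_eq (Ω : Matrix (Fin g) (Fin g) ℂ) (hΩ : ∀ i j, Ω i j = Ω j i)
    {c : ℝ} (hc : 0 < c) (hY : ∀ x : Fin g → ℝ, c * ∑ i, x i ^ 2 ≤ ∑ i, ∑ j, x i * (Ω i j).im * x j)
    (d : Fin g → ℕ) (hd : ∀ i, 0 < d i) {δ₀ : ℕ} (hδ : ∀ i, δ₀ ∣ d i) (hodd : Nat.Coprime 2 δ₀)
    (h3 : 3 ≤ δ₀) :
    typeDThetaSpace Ω d * typeDThetaSpace Ω d = levelThetaSpace Ω d 2 := by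
  rw [← levelThetaSpace_one]
  exact levelThetaSpace_one_mul_eq Ω hΩ hc hY d hd Nat.one_pos hδ hodd (by omega)

end Literature.Analysis.SpecialFunctions
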